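import Summits.HodgeConjecture.HodgeConjecture.Theorems.VHCAbelianSchemesRoadExtJumpLocusDescentTwist
import Summits.HodgeConjecture.HodgeConjecture.Theorems.VHCAbelianSchemesRoadExtVanishingBoxCoherent
import Summits.Ventures.HSemireg.DerivedEquivalenceTransport
import HarnessLib

/-!
# Road №4 (`VHCAbelianSchemesRoad`), crux stmt-HodgeConjecture-26512 `DiagLocalOfMarkmanPinnedForall` — route «2T»: THE UPSTAIRS COMPOSITION
# «ONE NON-JUMPING TWO-TORSION POINT FOR `q^*E•`» FROM ITS TYPED INPUTS (the socket of (N-U♭))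

research route conditional on HC_CM; not a corollary; Q11.4-sentence-2 already refuted in dim ≥ 3.

Seat prover-26512-2T-i g0, item (N-3) (director-hodge g18 R18.21: GO; claim-free; `--supports stmt-HodgeConjecture-26512 --as helper`; 0 new facts; costume hygiene (a)–(c)).
THIS FILE IS THE TYPED SOCKET OF ROUTE 2T: it proves nothing about the existence of its arguments; the kernel residue of (N-U♭) after it = (O₁) datum · (M5)+(M1)
descent quasi-iso · the two D(P)-isos ((M1) row + FM full faithfulness on two objects) · (vi) · two named facts.

`Cruxes/DiagLocalOfMarkmanPinnedForall/PENCIL-26512-TWOTORSION.md` §2 proves (N-U♭) «one non-jumping point upstairs» for print's carrier in six steps; the kernel holds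
(ii) (2T (i): `Theorems/VHCAbelianSchemesRoadExtJumpLocus{LinearisedTwist,DescentTwist}`, p685051 ∕ p685846 ∕ p686047 ∕ p686664) and (v) with coherent factors
(`Theorems/VHCAbelianSchemesRoadExtVanishingBoxCoherent`, p686540). This file COMPOSES them; its hypotheses fall into THREE CLASSES and nothing else:

**(1) DATA ∕ ARGUMENTS** (objects the missing library (M1)+(M5)+(O₁) must PRODUCE; assumed to exist here, never asserted): the secant–quotient datum `D`
(`q : P = J × Ĵ → Y`); the complex `E•` on `Y` (in §3: the carrier `𝓓.E` of an (O₁)-datum `(γ, 𝓓)`, `γ` pinned-served, `𝓓 : PinnedTwistedDatum C AdmTw′ …`); a bounded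
vector-bundle complex `𝓔` on `P` with `L` of rank one, `a` even and the DESCENT QUASI-ISOMORPHISM `f : q^*E• ⟶ (L^{⊗a})^∨ ⊗ 𝓔` (print: `q^*Ē_a ≅ 𝓔 ⊗ D^{−a}`, `D = det 𝓔`,
Markman Rem. 9.3.7 — the content of (M5)+(M1)); a two-torsion point `p ∈ P[2](ℂ)`; strictly perfect resolutions `R₁•, R₂•` of modules `G₁, G₂` on `J` and `S₁•, S₂•` of
`H₁, H₂` on `Ĵ`, with ISOMORPHISMS IN `D(P)` `e₁ : Q(τ_p^*•𝓔) ≅ Q(R₁• ⊠ S₁•)`, `e₂ : Q 𝓔 ≅ Q(R₂• ⊠ S₂•)` — the content of steps (iii)+(iv)+(v)-functorial, i.e. Orlov's ∕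
Mukai's exchange row at the pure translation `p` and the Fourier–Mukai functor's full faithfulness ON THESE TWO OBJECTS (print: `H₁ = I_{𝒵_C} ⊗ P_α`, `H₂ = I_{𝒵_C}`,
`α = φ_Θ(c) ∈ Ĵ[2] ∖ 0`; `Gᵢ` the translated ∕ twisted ideal of `𝒵_Σ`).
**(2) THE ONE MATHEMATICAL HYPOTHESIS**, step (vi): `hvi : ∀ j ≥ 0, Ext^j_Ĵ(H₁, H₂) = 0` (non-hyperelliptic `C`, `α` two-torsion: «`2λ ≠ 0` since `2p ∼ 2q` would be a `g¹₂`»).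
**(3) NAMED FACTS (2)**: `KunnethFormulaExt` (The Stacks Project 0FXZ, p681132) and `LocallyFreeRankOneIsInvertible` (0B8M, p685309), by name — the latter since
DISCHARGED (`LocallyFreeRankOneIsInvertible_holds`, typer-26512-m4 g1): §6 gives the primed forms with `KunnethFormulaExt` as the ONLY named fact.

CONCLUSIONS (§§1–4: box products ON `P` itself, `Φ = 𝟭`; **§5: the GENERAL SOCKET print needs** — box products on `A × B` (print `J × J`) reaching `D(P)` through a FULLY
FAITHFUL shift-commuting functor `Φ` = the Fourier–Mukai–Orlov equivalence as DATA, with `Φ(Q(R₁• ⊠ S₁•)) ≅ Q(τ_p^*•𝓔)`, `Φ(Q(R₂• ⊠ S₂•)) ≅ Q 𝓔`; the venture's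
`Summit.Ventures.HSemireg.subsingleton_hom_shift_iff` moves the Hom sets): §1 `not_mem_extJumpLocus_of_derivedBoxIsos` (on any `A × B`); §2 **`not_mem_extJumpLocus_quotientPullback_of_twoTorsion_inputs`** (`p ∉ J(q^*E•)`); §3 the LITERAL
inner conclusion of (N-U♭) — `∃ γ ∈ served, ∃ 𝓓, ∃ p, p ∉ J(q^*𝓓.E)`, the body of the lens line's `stub_oneNonJumpingPoint_End` (scratch `Cruxes/…/TwoTorsionRecut.lean`, not importable;
skeleton of record `Cruxes/DiagLocalOfMarkmanPinnedForall/Lines/birth.lean` v3.19 38e33fb905161877, whose registered stub (N-U) `stub_upstairsProperJumpCarrierExists_End` concludes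
`ProperJump D.P (quotientPullbackComplex D 𝓓.E)`) — **`oneNonJumpingPoint_of_inputs`**; §4 the inner conclusion of (N-U) BY NAME (`NowhereDisplaceable.ProperJump`, p672648), given in
ADDITION the closedness residue (N-C) AT THIS CARRIER as an argument — **`properJump_quotientPullback_of_inputs_of_closed`**. No stub is stated, restated or weakened here; nothing
touches `closes`, the skeleton or any stub. NOTHING here says (N-U♭), (N-U), (S4), the crux, №4, HC_AV, HC_CM or HC holds; HC_CM HELD, by name only; helper lane (width toward the crux = 0).
References: [cite: Markman2025SecantWeil, §9.3 Rem. 9.3.7, Lemma 9.3.5, Lemma 9.3.11; p. 52] [cite: Mukai1981, (3.1) and Thm. 2.2] [cite: StacksProject, Tag 0FXZ and Tag 0B8M]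
[cite: Lange2023AbelianVarietiesC, Thm. 1.3.5 and Prop. 1.4.6 (b)] [cite: GortzWedhorn2023, Thm. 23.139 (closedness of jump loci, the (N-C) residue)].
-/

noncomputable section

-- `TopCat.Presheaf`/`Scheme.Modules` are not reducible (as in Mathlib's `AlgebraicGeometry/Modules/Sheaf.lean`).
set_option backward.isDefEq.respectTransparency false

open CategoryTheory CategoryTheory.Category CategoryTheory.Limits AlgebraicGeometry

namespace Summit.HodgeConjecture.HodgeConjecture.Ring2.SemiregularRepresentatives

set_option linter.dupNamespace false -- the cell's namespace repeats the summit name, as in every `Ring2*` file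

namespace NowhereDisplaceable

open Literature.AlgebraicGeometry Literature.AlgebraicGeometry.Motives Literature.AlgebraicGeometry.Motives.AbelianVariety
open Literature.AlgebraicGeometry.Modules Literature.AlgebraicGeometry.HodgeTheory Literature.AlgebraicGeometry.KTheory
open Summit.HodgeConjecture.HodgeConjecture.Ring2.SemiregularRepresentatives.MoverTrap

/-! ## §1 On a product `A × B`: a point at which the carrier and its translate are, in `D`, box products with Ext-orthogonal resolved right factors does not jump -/

/-- **Steps (iii)–(vi) composed**: on `A ×ₖ B`, let `𝓔` be any cochain complex and `z` a point; if IN THE DERIVED CATEGORY `τ_z^*•𝓔 ≅ R₁• ⊠ S₁•` and `𝓔 ≅ R₂• ⊠ S₂•`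
for strictly perfect resolutions `Rᵢ•` (of modules on `A`) and `Sᵢ•` (of modules `Hᵢ` on `B`) with `Ext^j_B(H₁, H₂) = 0` for all `j ≥ 0`, then `z ∉ J(𝓔)` — vanishing
Künneth (`subsingleton_shiftedHom_boxTensor_resolutions_both_of_right`, under `KunnethFormulaExt`) transported along the two isomorphisms. [cite: StacksProject, Tag 0FXZ]
[cite: Markman2025SecantWeil, p. 52 (Künneth decomposition of Ext²)] [cite: Mukai1981, (3.1)] -/
theorem not_mem_extJumpLocus_of_derivedBoxIsos (hK : KunnethFormulaExt) (A B : AbelianVariety ℂ) (𝓔 : CochainComplex (A.prod B).X.left.Modules ℤ)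
    (z : (A.prod B).Points ℂ) {G₁ G₂ : A.X.left.Modules} (R₁ : StrictlyPerfectResolution G₁) (R₂ : StrictlyPerfectResolution G₂)
    {H₁ H₂ : B.X.left.Modules} (S₁ : StrictlyPerfectResolution H₁) (S₂ : StrictlyPerfectResolution H₂)
    (e₁ : letI := HasDerivedCategory.standard (A.prod B).X.left.Modules
      DerivedCategory.Q.obj (translationPullbackComplex (A.prod B) z 𝓔) ≅ DerivedCategory.Q.obj (A.boxTensorComplex B R₁.P S₁.P))
    (e₂ : letI := HasDerivedCategory.standard (A.prod B).X.left.Modules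
      DerivedCategory.Q.obj 𝓔 ≅ DerivedCategory.Q.obj (A.boxTensorComplex B R₂.P S₂.P))
    (hvi : ∀ j : ℕ, letI := HasDerivedCategory.standard B.X.left.Modules
      Subsingleton (ShiftedHom (DerivedCategory.Q.obj ((CochainComplex.singleFunctor B.X.left.Modules 0).obj H₁))
        (DerivedCategory.Q.obj ((CochainComplex.singleFunctor B.X.left.Modules 0).obj H₂)) (j : ℤ))) :
    z ∉ extJumpLocus (A.prod B) 𝓔 := by
  letI := HasDerivedCategory.standard (A.prod B).X.left.Modules
  simp only [extJumpLocus, Set.mem_setOf_eq, not_exists, not_not]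
  intro k
  rw [subsingleton_shiftedHom_congr_of_isoQ e₁ e₂ k]
  exact subsingleton_shiftedHom_boxTensor_resolutions_both_of_right A B hK R₁ R₂ S₁ S₂ hvi k

/-! ## §2 On `P = J × Ĵ` of a secant–quotient datum: the two-torsion point does not jump for `q^*E•` -/

/-- **ROUTE 2T, UPSTAIRS COMPOSITION — `p ∉ J(q^*E•)` FROM THE TYPED INPUTS.** For a secant–quotient datum `D` (`q : P = J × Ĵ → Y`), a complex `E•` on `Y`, a bounded
vector-bundle complex `𝓔` on `P`, `L` of rank one and `a` even with a quasi-isomorphism `f : q^*E• ⟶ (L^{⊗a})^∨ ⊗ 𝓔` (the descent identification, print's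
`q^*Ē_a ≅ 𝓔 ⊗ D^{−a}`), a two-torsion point `p ∈ P[2](ℂ)`, isomorphisms in `D(P)` `e₁ : Q(τ_p^*•𝓔) ≅ Q(R₁• ⊠ S₁•)`, `e₂ : Q 𝓔 ≅ Q(R₂• ⊠ S₂•)` with strictly perfect
resolutions of modules `Gᵢ` on `J`, `Hᵢ` on `Ĵ` (Orlov's row at the pure translation `p` + Φ̃ fully faithful on these two objects), and the vanishing (vi)
`Ext^{≥0}_Ĵ(H₁, H₂) = 0`: then `p ∉ J(q^*E•)`. CONDITIONAL on the named facts `KunnethFormulaExt` and `LocallyFreeRankOneIsInvertible` and on nothing else; every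
other input is an ARGUMENT. [cite: Markman2025SecantWeil, §9.3 Rem. 9.3.7 and Lemma 9.3.5; p. 52] [cite: Mukai1981, (3.1)] [cite: StacksProject, Tag 0FXZ and Tag 0B8M] -/
theorem not_mem_extJumpLocus_quotientPullback_of_twoTorsion_inputs (hK : KunnethFormulaExt) (hInv : LocallyFreeRankOneIsInvertible.{0})
    (D : SecantQuotientDatum) (E : CochainComplex D.Y.X.left.Modules ℤ) (𝓔 : CochainComplex D.P.X.left.Modules ℤ) (h𝓔vb : IsBoundedVBComplex 𝓔)
    {L : D.P.X.left.Modules} (hL : HasRank L 1) {a : ℕ} (ha : Even a)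
    (f : haveI := preservesZeroMorphisms_tensorBifunctor_obj (Modules.dual (tensorPow L a))
      quotientPullbackComplex D E ⟶ (((tensorBifunctor D.P.X.left).obj (Modules.dual (tensorPow L a))).mapHomologicalComplex (ComplexShape.up ℤ)).obj 𝓔)
    (hf : haveI := preservesZeroMorphisms_tensorBifunctor_obj (Modules.dual (tensorPow L a)); QuasiIso f)
    {p : D.P.Points ℂ} (hp : p ∈ D.P.torsionPoints ℂ 2)
    {G₁ G₂ : D.𝒥.J.X.left.Modules} (R₁ : StrictlyPerfectResolution G₁) (R₂ : StrictlyPerfectResolution G₂)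
    {H₁ H₂ : (D.𝒥.J.dualOf D.Θ D.isAmple).X.left.Modules} (S₁ : StrictlyPerfectResolution H₁) (S₂ : StrictlyPerfectResolution H₂)
    (e₁ : letI := HasDerivedCategory.standard D.P.X.left.Modules
      DerivedCategory.Q.obj (translationPullbackComplex D.P p 𝓔) ≅
        DerivedCategory.Q.obj (D.𝒥.J.boxTensorComplex (D.𝒥.J.dualOf D.Θ D.isAmple) R₁.P S₁.P))
    (e₂ : letI := HasDerivedCategory.standard D.P.X.left.Modules
      DerivedCategory.Q.obj 𝓔 ≅ DerivedCategory.Q.obj (D.𝒥.J.boxTensorComplex (D.𝒥.J.dualOf D.Θ D.isAmple) R₂.P S₂.P))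
    (hvi : ∀ j : ℕ, letI := HasDerivedCategory.standard (D.𝒥.J.dualOf D.Θ D.isAmple).X.left.Modules
      Subsingleton (ShiftedHom (DerivedCategory.Q.obj ((CochainComplex.singleFunctor _ 0).obj H₁))
        (DerivedCategory.Q.obj ((CochainComplex.singleFunctor _ 0).obj H₂)) (j : ℤ))) :
    p ∉ extJumpLocus D.P (quotientPullbackComplex D E) :=
  not_mem_extJumpLocus_quotientPullback_of_quasiIso_dualTensorPow_twist hInv D E hL ha hp 𝓔 h𝓔vb f hf
    (not_mem_extJumpLocus_of_derivedBoxIsos hK D.𝒥.J (D.𝒥.J.dualOf D.Θ D.isAmple) 𝓔 p R₁ R₂ S₁ S₂ e₁ e₂ hvi)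

/-! ## §3 The literal (N-U♭) packaging: from an (O₁)-datum whose carrier has the inputs -/

/-- **(N-U♭)'s conclusion, literally, from the inputs**: at a datum `D` with polarisation class `θ₀`, an (O₁)-DATUM — a pinned-served class `γ` and an `AdmTw′`-pinned twisted
datum `𝓓` of class `γ` (print: `Ē_{a′}` resolved, `(d, a′) = (6, 8)`) — whose carrier `𝓓.E` comes with the §2 inputs (descent quasi-iso to `(L^{⊗a})^∨ ⊗ 𝓔`, the two `D(P)`-isos at a
two-torsion point `p`, the vanishing (vi)) yields `∃ γ ∈ served, ∃ 𝓓, ∃ p, p ∉ J(q^*𝓓.E)` — the body of the lens line's `stub_oneNonJumpingPoint_End` at `D` (its hypotheses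
`¬hyperelliptic`, H-good, polarised, End-trivial are where print's (O₁) and (vi) come from; they are not consumed by the composition itself). CONDITIONAL on `KunnethFormulaExt` and
`LocallyFreeRankOneIsInvertible`. [cite: Markman2025SecantWeil, §9.3 Lemma 9.3.11 and Rem. 9.3.7] [cite: StacksProject, Tag 0FXZ and Tag 0B8M] -/
theorem oneNonJumpingPoint_of_inputs (hK : KunnethFormulaExt) (hInv : LocallyFreeRankOneIsInvertible.{0}) (C : ChernCharacterBetti)
    (D : SecantQuotientDatum) (θ₀ : complexBetti D.𝒥.J.X 2) {γ : complexBetti D.Y.X (2 * 3)} (hγ : γ ∈ secantQuotientServedClassesPinned D.Y.X (D.hY θ₀))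
    (𝓓 : PinnedTwistedDatum C AdmTw' D.Y.X (D.hY θ₀) γ) (𝓔 : CochainComplex D.P.X.left.Modules ℤ) (h𝓔vb : IsBoundedVBComplex 𝓔)
    {L : D.P.X.left.Modules} (hL : HasRank L 1) {a : ℕ} (ha : Even a)
    (f : haveI := preservesZeroMorphisms_tensorBifunctor_obj (Modules.dual (tensorPow L a))
      quotientPullbackComplex D 𝓓.E ⟶ (((tensorBifunctor D.P.X.left).obj (Modules.dual (tensorPow L a))).mapHomologicalComplex (ComplexShape.up ℤ)).obj 𝓔)
    (hf : haveI := preservesZeroMorphisms_tensorBifunctor_obj (Modules.dual (tensorPow L a)); QuasiIso f)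
    {p : D.P.Points ℂ} (hp : p ∈ D.P.torsionPoints ℂ 2)
    {G₁ G₂ : D.𝒥.J.X.left.Modules} (R₁ : StrictlyPerfectResolution G₁) (R₂ : StrictlyPerfectResolution G₂)
    {H₁ H₂ : (D.𝒥.J.dualOf D.Θ D.isAmple).X.left.Modules} (S₁ : StrictlyPerfectResolution H₁) (S₂ : StrictlyPerfectResolution H₂)
    (e₁ : letI := HasDerivedCategory.standard D.P.X.left.Modules
      DerivedCategory.Q.obj (translationPullbackComplex D.P p 𝓔) ≅
        DerivedCategory.Q.obj (D.𝒥.J.boxTensorComplex (D.𝒥.J.dualOf D.Θ D.isAmple) R₁.P S₁.P))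
    (e₂ : letI := HasDerivedCategory.standard D.P.X.left.Modules
      DerivedCategory.Q.obj 𝓔 ≅ DerivedCategory.Q.obj (D.𝒥.J.boxTensorComplex (D.𝒥.J.dualOf D.Θ D.isAmple) R₂.P S₂.P))
    (hvi : ∀ j : ℕ, letI := HasDerivedCategory.standard (D.𝒥.J.dualOf D.Θ D.isAmple).X.left.Modules
      Subsingleton (ShiftedHom (DerivedCategory.Q.obj ((CochainComplex.singleFunctor _ 0).obj H₁))
        (DerivedCategory.Q.obj ((CochainComplex.singleFunctor _ 0).obj H₂)) (j : ℤ))) :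
    ∃ γ ∈ secantQuotientServedClassesPinned D.Y.X (D.hY θ₀), ∃ 𝓓 : PinnedTwistedDatum C AdmTw' D.Y.X (D.hY θ₀) γ, ∃ p : D.P.Points ℂ,
      p ∉ extJumpLocus D.P (quotientPullbackComplex D 𝓓.E) :=
  ⟨γ, hγ, 𝓓, p, not_mem_extJumpLocus_quotientPullback_of_twoTorsion_inputs hK hInv D 𝓓.E 𝓔 h𝓔vb hL ha f hf hp R₁ R₂ S₁ S₂ e₁ e₂ hvi⟩

/-! ## §4 With the closedness residue (N-C) at this carrier: the inner conclusion of (N-U) by name (`ProperJump`) -/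

/-- **(N-U)'s inner conclusion `ProperJump D.P (q^*𝓓.E)` BY NAME, from the inputs PLUS the closedness residue (N-C) AT THIS CARRIER** — an argument `(V, ι)`: a closed
subscheme of `P` whose `ℂ`-points are exactly the Ext-jump locus of `q^*𝓓.E` (derived semicontinuity, Görtz–Wedhorn II Thm. 23.139 — NOT proved here). Then `V` itself is the
witness: its points miss `p`, and `J ⊆ {1} ∪ V(ℂ)`. The costume self-test of the memo §4 applies: as a node this is (N-U♭) + (N-C), one floor sideways. CONDITIONAL on
`KunnethFormulaExt` + `LocallyFreeRankOneIsInvertible`. [cite: GortzWedhorn2023, Thm. 23.139] [cite: Markman2025SecantWeil, §9.3 Lemma 9.3.11] -/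
theorem properJump_quotientPullback_of_inputs_of_closed (hK : KunnethFormulaExt) (hInv : LocallyFreeRankOneIsInvertible.{0})
    (D : SecantQuotientDatum) (E : CochainComplex D.Y.X.left.Modules ℤ) (𝓔 : CochainComplex D.P.X.left.Modules ℤ) (h𝓔vb : IsBoundedVBComplex 𝓔)
    {L : D.P.X.left.Modules} (hL : HasRank L 1) {a : ℕ} (ha : Even a)
    (f : haveI := preservesZeroMorphisms_tensorBifunctor_obj (Modules.dual (tensorPow L a))
      quotientPullbackComplex D E ⟶ (((tensorBifunctor D.P.X.left).obj (Modules.dual (tensorPow L a))).mapHomologicalComplex (ComplexShape.up ℤ)).obj 𝓔)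
    (hf : haveI := preservesZeroMorphisms_tensorBifunctor_obj (Modules.dual (tensorPow L a)); QuasiIso f)
    {p : D.P.Points ℂ} (hp : p ∈ D.P.torsionPoints ℂ 2)
    {G₁ G₂ : D.𝒥.J.X.left.Modules} (R₁ : StrictlyPerfectResolution G₁) (R₂ : StrictlyPerfectResolution G₂)
    {H₁ H₂ : (D.𝒥.J.dualOf D.Θ D.isAmple).X.left.Modules} (S₁ : StrictlyPerfectResolution H₁) (S₂ : StrictlyPerfectResolution H₂)
    (e₁ : letI := HasDerivedCategory.standard D.P.X.left.Modules
      DerivedCategory.Q.obj (translationPullbackComplex D.P p 𝓔) ≅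
        DerivedCategory.Q.obj (D.𝒥.J.boxTensorComplex (D.𝒥.J.dualOf D.Θ D.isAmple) R₁.P S₁.P))
    (e₂ : letI := HasDerivedCategory.standard D.P.X.left.Modules
      DerivedCategory.Q.obj 𝓔 ≅ DerivedCategory.Q.obj (D.𝒥.J.boxTensorComplex (D.𝒥.J.dualOf D.Θ D.isAmple) R₂.P S₂.P))
    (hvi : ∀ j : ℕ, letI := HasDerivedCategory.standard (D.𝒥.J.dualOf D.Θ D.isAmple).X.left.Modules
      Subsingleton (ShiftedHom (DerivedCategory.Q.obj ((CochainComplex.singleFunctor _ 0).obj H₁))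
        (DerivedCategory.Q.obj ((CochainComplex.singleFunctor _ 0).obj H₂)) (j : ℤ)))
    (V : SchemeOver ℂ) (ι : V ⟶ D.P.X) (hι : IsClosedImmersion ι.left)
    (hV : Set.range (AlgPoints.map (L := ℂ) ι) = extJumpLocus D.P (quotientPullbackComplex D E)) :
    ProperJump D.P (quotientPullbackComplex D E) := by
  have hp' := not_mem_extJumpLocus_quotientPullback_of_twoTorsion_inputs hK hInv D E 𝓔 h𝓔vb hL ha f hf hp R₁ R₂ S₁ S₂ e₁ e₂ hvi
  refine ⟨V, ι, hι, ?_, ?_⟩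
  · intro h
    rw [hV] at h
    exact hp' (h ▸ Set.mem_univ p)
  · rw [hV]
    exact Set.subset_union_right

/-! ## §5 (APPEND, same seat) THE GENERAL SOCKET: the box products live on `A × B` and reach `P` through a FULLY FAITHFUL, shift-commuting functor `Φ`
between the derived categories (print: `A = B = J`, `Φ` = Orlov's `Φ̃ = (1 × Ψ) ∘ μ^*` composed with dual∕shift — an equivalence `D(J × J) ⥤ D(J × Ĵ)`).
§§2–4 are the case `A × B = P`, `Φ = 𝟭`; for print's carrier `𝓔` is NOT a box product in `D(P)` but the Φ-IMAGE of one, so THESE are the forms (M1) feeds: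
its row gives `Φ(Q(R₁• ⊠ S₁•)) ≅ Q(τ_p^*•𝓔)` and `Φ(Q(R₂• ⊠ S₂•)) ≅ Q 𝓔`, and Φ's full faithfulness moves the Hom sets (the venture's
`Summit.Ventures.HSemireg.subsingleton_hom_shift_iff`, p-id of `DerivedEquivalenceTransport`). `Φ` and the two isomorphisms are DATA (class (1)); the chain-level
rule R18.21 (d) is kept: `τ_p^*` is applied at chain level, `Φ` and the isos enter afterwards, in `D(P)`. -/

/-- **Steps (iii)–(vi) through a fully faithful `Φ`**: on `P`, a complex `𝓔` and a point `z`; on `A × B`, strictly perfect resolutions `Rᵢ•` (on `A`), `Sᵢ•` (of `Hᵢ` on `B`) with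
`Ext^{≥0}_B(H₁, H₂) = 0`; a full, faithful, shift-commuting `Φ : D(Mod_{A×B}) ⥤ D(Mod_P)` with `Φ(Q(R₁• ⊠ S₁•)) ≅ Q(τ_z^*•𝓔)` and `Φ(Q(R₂• ⊠ S₂•)) ≅ Q 𝓔` ⟹ `z ∉ J(𝓔)`.
CONDITIONAL on `KunnethFormulaExt`. [cite: Mukai1981, Thm. 2.2 and (3.1)] [cite: StacksProject, Tag 0FXZ] [cite: Markman2025SecantWeil, §9.3 Lemma 9.3.3 and p. 52] -/
theorem not_mem_extJumpLocus_of_fullyFaithful_boxIsos (hK : KunnethFormulaExt) (A B P : AbelianVariety ℂ) (𝓔 : CochainComplex P.X.left.Modules ℤ)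
    (z : P.Points ℂ) {G₁ G₂ : A.X.left.Modules} (R₁ : StrictlyPerfectResolution G₁) (R₂ : StrictlyPerfectResolution G₂)
    {H₁ H₂ : B.X.left.Modules} (S₁ : StrictlyPerfectResolution H₁) (S₂ : StrictlyPerfectResolution H₂)
    (hvi : ∀ j : ℕ, letI := HasDerivedCategory.standard B.X.left.Modules
      Subsingleton (ShiftedHom (DerivedCategory.Q.obj ((CochainComplex.singleFunctor B.X.left.Modules 0).obj H₁))
        (DerivedCategory.Q.obj ((CochainComplex.singleFunctor B.X.left.Modules 0).obj H₂)) (j : ℤ))) :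
    letI := HasDerivedCategory.standard (A.prod B).X.left.Modules
    letI := HasDerivedCategory.standard P.X.left.Modules
    ∀ (Φ : DerivedCategory (A.prod B).X.left.Modules ⥤ DerivedCategory P.X.left.Modules) [Φ.CommShift ℤ] [Φ.Full] [Φ.Faithful]
      (_ : Φ.obj (DerivedCategory.Q.obj (A.boxTensorComplex B R₁.P S₁.P)) ≅ DerivedCategory.Q.obj (translationPullbackComplex P z 𝓔))
      (_ : Φ.obj (DerivedCategory.Q.obj (A.boxTensorComplex B R₂.P S₂.P)) ≅ DerivedCategory.Q.obj 𝓔),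
      z ∉ extJumpLocus P 𝓔 := by
  letI := HasDerivedCategory.standard (A.prod B).X.left.Modules
  letI := HasDerivedCategory.standard P.X.left.Modules
  intro Φ _ _ _ e₁ e₂
  simp only [extJumpLocus, Set.mem_setOf_eq, not_exists, not_not]
  intro k
  have h := subsingleton_shiftedHom_boxTensor_resolutions_both_of_right A B hK R₁ R₂ S₁ S₂ hvi k
  rw [← Summit.Ventures.HSemireg.subsingleton_hom_shift_iff Φ _ _ k] at h
  exact (e₁.homCongr ((shiftFunctor _ k).mapIso e₂)).subsingleton_congr.mp h

/-- **ROUTE 2T, THE GENERAL UPSTAIRS SOCKET — `p ∉ J(q^*E•)` FROM THE TYPED INPUTS, box products on `A × B` through `Φ`.** DATA: the datum `D`, `E•` on `Y`, the bounded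
VB complex `𝓔` on `P` with the descent quasi-iso `f : q^*E• ⟶ (L^{⊗a})^∨ ⊗ 𝓔` (`a` even, `L` rank one), `p ∈ P[2](ℂ)`, resolutions `Rᵢ•`, `Sᵢ•` on `A`, `B` (print: `A = B = J`), the functor
`Φ` (full, faithful, shift-commuting) with the two isomorphisms in `D(P)`; THE ONE MATHEMATICAL HYPOTHESIS (vi) `Ext^{≥0}_B(H₁, H₂) = 0`; NAMED FACTS `KunnethFormulaExt`,
`LocallyFreeRankOneIsInvertible`. [cite: Markman2025SecantWeil, §9.3 Rem. 9.3.7 and Lemma 9.3.5; p. 52] [cite: Mukai1981, Thm. 2.2 and (3.1)] [cite: StacksProject, Tag 0FXZ and Tag 0B8M] -/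
theorem not_mem_extJumpLocus_quotientPullback_of_twoTorsion_inputs_fullyFaithful (hK : KunnethFormulaExt) (hInv : LocallyFreeRankOneIsInvertible.{0})
    (D : SecantQuotientDatum) (E : CochainComplex D.Y.X.left.Modules ℤ) (𝓔 : CochainComplex D.P.X.left.Modules ℤ) (h𝓔vb : IsBoundedVBComplex 𝓔)
    {L : D.P.X.left.Modules} (hL : HasRank L 1) {a : ℕ} (ha : Even a)
    (f : haveI := preservesZeroMorphisms_tensorBifunctor_obj (Modules.dual (tensorPow L a))
      quotientPullbackComplex D E ⟶ (((tensorBifunctor D.P.X.left).obj (Modules.dual (tensorPow L a))).mapHomologicalComplex (ComplexShape.up ℤ)).obj 𝓔)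
    (hf : haveI := preservesZeroMorphisms_tensorBifunctor_obj (Modules.dual (tensorPow L a)); QuasiIso f)
    {p : D.P.Points ℂ} (hp : p ∈ D.P.torsionPoints ℂ 2) (A B : AbelianVariety ℂ)
    {G₁ G₂ : A.X.left.Modules} (R₁ : StrictlyPerfectResolution G₁) (R₂ : StrictlyPerfectResolution G₂)
    {H₁ H₂ : B.X.left.Modules} (S₁ : StrictlyPerfectResolution H₁) (S₂ : StrictlyPerfectResolution H₂)
    (hvi : ∀ j : ℕ, letI := HasDerivedCategory.standard B.X.left.Modules
      Subsingleton (ShiftedHom (DerivedCategory.Q.obj ((CochainComplex.singleFunctor B.X.left.Modules 0).obj H₁))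
        (DerivedCategory.Q.obj ((CochainComplex.singleFunctor B.X.left.Modules 0).obj H₂)) (j : ℤ))) :
    letI := HasDerivedCategory.standard (A.prod B).X.left.Modules
    letI := HasDerivedCategory.standard D.P.X.left.Modules
    ∀ (Φ : DerivedCategory (A.prod B).X.left.Modules ⥤ DerivedCategory D.P.X.left.Modules) [Φ.CommShift ℤ] [Φ.Full] [Φ.Faithful]
      (_ : Φ.obj (DerivedCategory.Q.obj (A.boxTensorComplex B R₁.P S₁.P)) ≅ DerivedCategory.Q.obj (translationPullbackComplex D.P p 𝓔))
      (_ : Φ.obj (DerivedCategory.Q.obj (A.boxTensorComplex B R₂.P S₂.P)) ≅ DerivedCategory.Q.obj 𝓔),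
      p ∉ extJumpLocus D.P (quotientPullbackComplex D E) := by
  intro Φ _ _ _ e₁ e₂
  exact not_mem_extJumpLocus_quotientPullback_of_quasiIso_dualTensorPow_twist hInv D E hL ha hp 𝓔 h𝓔vb f hf
    (not_mem_extJumpLocus_of_fullyFaithful_boxIsos hK A B D.P 𝓔 p R₁ R₂ S₁ S₂ hvi Φ e₁ e₂)

/-- **The literal (N-U♭) packaging, general socket**: from an (O₁)-datum `(γ, 𝓓)` at `(D, θ₀)` whose carrier `𝓓.E` comes with the DATA above (through `Φ`),
`∃ γ ∈ served, ∃ 𝓓, ∃ p, p ∉ J(q^*𝓓.E)`. CONDITIONAL on `KunnethFormulaExt` + `LocallyFreeRankOneIsInvertible`. [cite: Markman2025SecantWeil, §9.3 Lemma 9.3.11 and Rem. 9.3.7]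
[cite: Mukai1981, Thm. 2.2 and (3.1)] -/
theorem oneNonJumpingPoint_of_inputs_fullyFaithful (hK : KunnethFormulaExt) (hInv : LocallyFreeRankOneIsInvertible.{0}) (C : ChernCharacterBetti)
    (D : SecantQuotientDatum) (θ₀ : complexBetti D.𝒥.J.X 2) {γ : complexBetti D.Y.X (2 * 3)} (hγ : γ ∈ secantQuotientServedClassesPinned D.Y.X (D.hY θ₀))
    (𝓓 : PinnedTwistedDatum C AdmTw' D.Y.X (D.hY θ₀) γ) (𝓔 : CochainComplex D.P.X.left.Modules ℤ) (h𝓔vb : IsBoundedVBComplex 𝓔)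
    {L : D.P.X.left.Modules} (hL : HasRank L 1) {a : ℕ} (ha : Even a)
    (f : haveI := preservesZeroMorphisms_tensorBifunctor_obj (Modules.dual (tensorPow L a))
      quotientPullbackComplex D 𝓓.E ⟶ (((tensorBifunctor D.P.X.left).obj (Modules.dual (tensorPow L a))).mapHomologicalComplex (ComplexShape.up ℤ)).obj 𝓔)
    (hf : haveI := preservesZeroMorphisms_tensorBifunctor_obj (Modules.dual (tensorPow L a)); QuasiIso f)
    {p : D.P.Points ℂ} (hp : p ∈ D.P.torsionPoints ℂ 2) (A B : AbelianVariety ℂ)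
    {G₁ G₂ : A.X.left.Modules} (R₁ : StrictlyPerfectResolution G₁) (R₂ : StrictlyPerfectResolution G₂)
    {H₁ H₂ : B.X.left.Modules} (S₁ : StrictlyPerfectResolution H₁) (S₂ : StrictlyPerfectResolution H₂)
    (hvi : ∀ j : ℕ, letI := HasDerivedCategory.standard B.X.left.Modules
      Subsingleton (ShiftedHom (DerivedCategory.Q.obj ((CochainComplex.singleFunctor B.X.left.Modules 0).obj H₁))
        (DerivedCategory.Q.obj ((CochainComplex.singleFunctor B.X.left.Modules 0).obj H₂)) (j : ℤ))) :
    letI := HasDerivedCategory.standard (A.prod B).X.left.Modules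
    letI := HasDerivedCategory.standard D.P.X.left.Modules
    ∀ (Φ : DerivedCategory (A.prod B).X.left.Modules ⥤ DerivedCategory D.P.X.left.Modules) [Φ.CommShift ℤ] [Φ.Full] [Φ.Faithful]
      (_ : Φ.obj (DerivedCategory.Q.obj (A.boxTensorComplex B R₁.P S₁.P)) ≅ DerivedCategory.Q.obj (translationPullbackComplex D.P p 𝓔))
      (_ : Φ.obj (DerivedCategory.Q.obj (A.boxTensorComplex B R₂.P S₂.P)) ≅ DerivedCategory.Q.obj 𝓔),
      ∃ γ ∈ secantQuotientServedClassesPinned D.Y.X (D.hY θ₀), ∃ 𝓓 : PinnedTwistedDatum C AdmTw' D.Y.X (D.hY θ₀) γ, ∃ p : D.P.Points ℂ,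
        p ∉ extJumpLocus D.P (quotientPullbackComplex D 𝓓.E) := by
  intro Φ _ _ _ e₁ e₂
  exact ⟨γ, hγ, 𝓓, p, not_mem_extJumpLocus_quotientPullback_of_twoTorsion_inputs_fullyFaithful hK hInv D 𝓓.E 𝓔 h𝓔vb hL ha f hf hp A B R₁ R₂ S₁ S₂
    hvi Φ e₁ e₂⟩

/-! ## §6 (APPEND, same seat) 0B8M DISCHARGED — the socket with ONE named fact (`KunnethFormulaExt`) only
`Modules.LocallyFreeRankOneIsInvertible_holds` (typer-26512-m4 g1, `Modules/InvertibleOfRankOne`) proves Stacks 0B8M for the tree's `tensorObj`, so the class-(3) list of the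
socket shrinks to `KunnethFormulaExt`; everything else is unchanged (DATA as in §5, THE ONE MATHEMATICAL HYPOTHESIS (vi)). -/

/-- **ROUTE 2T, THE GENERAL SOCKET with `KunnethFormulaExt` as the ONLY named fact** (0B8M discharged by `LocallyFreeRankOneIsInvertible_holds`): DATA and (vi) as in
`not_mem_extJumpLocus_quotientPullback_of_twoTorsion_inputs_fullyFaithful` ⟹ `p ∉ J(q^*E•)`. [cite: Markman2025SecantWeil, §9.3 Rem. 9.3.7 and Lemma 9.3.5; p. 52] [cite: Mukai1981, Thm. 2.2 and (3.1)]
[cite: StacksProject, Tag 0FXZ] -/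
theorem not_mem_extJumpLocus_quotientPullback_of_twoTorsion_inputs_fullyFaithful' (hK : KunnethFormulaExt)
    (D : SecantQuotientDatum) (E : CochainComplex D.Y.X.left.Modules ℤ) (𝓔 : CochainComplex D.P.X.left.Modules ℤ) (h𝓔vb : IsBoundedVBComplex 𝓔)
    {L : D.P.X.left.Modules} (hL : HasRank L 1) {a : ℕ} (ha : Even a)
    (f : haveI := preservesZeroMorphisms_tensorBifunctor_obj (Modules.dual (tensorPow L a))
      quotientPullbackComplex D E ⟶ (((tensorBifunctor D.P.X.left).obj (Modules.dual (tensorPow L a))).mapHomologicalComplex (ComplexShape.up ℤ)).obj 𝓔)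
    (hf : haveI := preservesZeroMorphisms_tensorBifunctor_obj (Modules.dual (tensorPow L a)); QuasiIso f)
    {p : D.P.Points ℂ} (hp : p ∈ D.P.torsionPoints ℂ 2) (A B : AbelianVariety ℂ)
    {G₁ G₂ : A.X.left.Modules} (R₁ : StrictlyPerfectResolution G₁) (R₂ : StrictlyPerfectResolution G₂)
    {H₁ H₂ : B.X.left.Modules} (S₁ : StrictlyPerfectResolution H₁) (S₂ : StrictlyPerfectResolution H₂)
    (hvi : ∀ j : ℕ, letI := HasDerivedCategory.standard B.X.left.Modules
      Subsingleton (ShiftedHom (DerivedCategory.Q.obj ((CochainComplex.singleFunctor B.X.left.Modules 0).obj H₁))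
        (DerivedCategory.Q.obj ((CochainComplex.singleFunctor B.X.left.Modules 0).obj H₂)) (j : ℤ))) :
    letI := HasDerivedCategory.standard (A.prod B).X.left.Modules
    letI := HasDerivedCategory.standard D.P.X.left.Modules
    ∀ (Φ : DerivedCategory (A.prod B).X.left.Modules ⥤ DerivedCategory D.P.X.left.Modules) [Φ.CommShift ℤ] [Φ.Full] [Φ.Faithful]
      (_ : Φ.obj (DerivedCategory.Q.obj (A.boxTensorComplex B R₁.P S₁.P)) ≅ DerivedCategory.Q.obj (translationPullbackComplex D.P p 𝓔))
      (_ : Φ.obj (DerivedCategory.Q.obj (A.boxTensorComplex B R₂.P S₂.P)) ≅ DerivedCategory.Q.obj 𝓔),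
      p ∉ extJumpLocus D.P (quotientPullbackComplex D E) :=
  not_mem_extJumpLocus_quotientPullback_of_twoTorsion_inputs_fullyFaithful hK LocallyFreeRankOneIsInvertible_holds D E 𝓔 h𝓔vb hL ha f hf hp A B
    R₁ R₂ S₁ S₂ hvi

/-- **The literal (N-U♭) packaging with `KunnethFormulaExt` as the ONLY named fact.** [cite: Markman2025SecantWeil, §9.3 Lemma 9.3.11 and Rem. 9.3.7] [cite: Mukai1981, Thm. 2.2 and (3.1)]
[cite: StacksProject, Tag 0FXZ] -/
theorem oneNonJumpingPoint_of_inputs_fullyFaithful' (hK : KunnethFormulaExt) (C : ChernCharacterBetti)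
    (D : SecantQuotientDatum) (θ₀ : complexBetti D.𝒥.J.X 2) {γ : complexBetti D.Y.X (2 * 3)} (hγ : γ ∈ secantQuotientServedClassesPinned D.Y.X (D.hY θ₀))
    (𝓓 : PinnedTwistedDatum C AdmTw' D.Y.X (D.hY θ₀) γ) (𝓔 : CochainComplex D.P.X.left.Modules ℤ) (h𝓔vb : IsBoundedVBComplex 𝓔)
    {L : D.P.X.left.Modules} (hL : HasRank L 1) {a : ℕ} (ha : Even a)
    (f : haveI := preservesZeroMorphisms_tensorBifunctor_obj (Modules.dual (tensorPow L a))
      quotientPullbackComplex D 𝓓.E ⟶ (((tensorBifunctor D.P.X.left).obj (Modules.dual (tensorPow L a))).mapHomologicalComplex (ComplexShape.up ℤ)).obj 𝓔)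
    (hf : haveI := preservesZeroMorphisms_tensorBifunctor_obj (Modules.dual (tensorPow L a)); QuasiIso f)
    {p : D.P.Points ℂ} (hp : p ∈ D.P.torsionPoints ℂ 2) (A B : AbelianVariety ℂ)
    {G₁ G₂ : A.X.left.Modules} (R₁ : StrictlyPerfectResolution G₁) (R₂ : StrictlyPerfectResolution G₂)
    {H₁ H₂ : B.X.left.Modules} (S₁ : StrictlyPerfectResolution H₁) (S₂ : StrictlyPerfectResolution H₂)
    (hvi : ∀ j : ℕ, letI := HasDerivedCategory.standard B.X.left.Modules
      Subsingleton (ShiftedHom (DerivedCategory.Q.obj ((CochainComplex.singleFunctor B.X.left.Modules 0).obj H₁))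
        (DerivedCategory.Q.obj ((CochainComplex.singleFunctor B.X.left.Modules 0).obj H₂)) (j : ℤ))) :
    letI := HasDerivedCategory.standard (A.prod B).X.left.Modules
    letI := HasDerivedCategory.standard D.P.X.left.Modules
    ∀ (Φ : DerivedCategory (A.prod B).X.left.Modules ⥤ DerivedCategory D.P.X.left.Modules) [Φ.CommShift ℤ] [Φ.Full] [Φ.Faithful]
      (_ : Φ.obj (DerivedCategory.Q.obj (A.boxTensorComplex B R₁.P S₁.P)) ≅ DerivedCategory.Q.obj (translationPullbackComplex D.P p 𝓔))
      (_ : Φ.obj (DerivedCategory.Q.obj (A.boxTensorComplex B R₂.P S₂.P)) ≅ DerivedCategory.Q.obj 𝓔),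
      ∃ γ ∈ secantQuotientServedClassesPinned D.Y.X (D.hY θ₀), ∃ 𝓓 : PinnedTwistedDatum C AdmTw' D.Y.X (D.hY θ₀) γ, ∃ p : D.P.Points ℂ,
        p ∉ extJumpLocus D.P (quotientPullbackComplex D 𝓓.E) :=
  oneNonJumpingPoint_of_inputs_fullyFaithful hK LocallyFreeRankOneIsInvertible_holds C D θ₀ hγ 𝓓 𝓔 h𝓔vb hL ha f hf hp A B R₁ R₂ S₁ S₂ hvi

end NowhereDisplaceable

end Summit.HodgeConjecture.HodgeConjecture.Ring2.SemiregularRepresentatives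

end
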